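import Literature.MathematicalPhysics.QuantumFieldTheory.Balaban1983to89.AveragingRT
import Literature.MathematicalPhysics.QuantumFieldTheory.Balaban1983to89.B16ZLower

/-!
# `Balaban1983to89.B12FaddeevPopov016` — [Balaban1987RG1] (0.13)–(0.16) pp. 254–255: the kernel form of a
renormalization transformation, the Faddeev–Popov identity (0.15) PROVED from Haar invariance, the gauge-fixing
weight of (0.16), and (0.16) itself PROVED for gauge-invariant kernels and densities

HONEST FRAMING (cell `lit-balaban`, verbatim): statement-level skeleton of published theorems with citation tags;
proofs where landed; nothing here is a claim about the Yang–Mills mass gap.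

CITATION HEADER.  T. Bałaban, *Renormalization group approach to lattice gauge field theories. I. Generation of
effective actions in a small field approximation and a coupling constant renormalization in four dimensions*,
Commun. Math. Phys. **109** (1987) 249–301, doi:10.1007/bf01215223 [Balaban1987RG1] (cell paper B12; held text
`paper:balaban1987-cmp109-rg-i-small-field`, journal page = PDF page + 248; the displays (0.13)–(0.16) were read from
the page renders `b2b-balaban-ref1/pages/1987-cmp109-rg-I-small-field/…-p006-x2.png` (p. 254) and `…-p007-x2.png`
(p. 255)).  Unit `lit-balaban-r09` (reader/typer of CMP 109), SKELETON rows `B12-0.13`, `B12-0.15`, `B12-0.16`.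

WHAT IS PRINTED (verbatim).  p. 254: *«Now we consider renormalization transformations, which have the general form
(Tρ)(V) = ∫dU t(V,U)ρ(U). (0.13)  Here U, V are gauge field configurations on the lattices T, T⁽¹⁾ correspondingly,
and t(V,U) is a gauge invariant kernel, for example see the definitions in [9, 12]. If ρ is a gauge invariant
function, then Tρ is gauge invariant also.»* … *«Even with these restrictions the underintegral expression in (0.13)
is still invariant with respect to the gauge transformations u satisfying u(y) = 1 for y ∈ T⁽¹⁾. We have to fix a
gauge in order to remove this invariance»* … *«Instead we introduce exponential gauge fixing functions,
exp[−(1/2α)|U(y,x) − 1|²] = exp[−(1/α)[1 − Re tr U(y,x)]]. (0.14)  It is convenient to introduce simultaneously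
restrictions on the variables U(y,x). We have the following identities for y ∈ T⁽¹⁾, x ∈ B(y), x ≠ y,
(1/z)∫du(x) exp[−(1/α)[1 − Re tr U(y,x)u⁻¹(x)]] χ({|U(y,x)u⁻¹(x) − 1| < ε₀})
  = (1/z)∫du(x) exp[−(1/α)[1 − Re tr u(x)]] χ({|u(x) − 1| < ε₀}) = 1, (0.15)»*  p. 255: *«where z is defined by the
last integral. We introduce (0.15) under the integral in (0.13) and we apply the usual Faddeev-Popov procedure, i.e.
we change the order of integrations and apply the gauge transformation U → U^{u⁻¹} with u(y) = 1 for y ∈ T⁽¹⁾. By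
the gauge invariance with respect to such transformations the integrand does not depend on u and the integral over u
is equal to 1. Thus we get
(Tρ)(V) = ∫dU t(V,U) Π_{y∈T⁽¹⁾} Π_{x∈B(y),x≠y} (1/z) exp[−(1/α)[1 − Re tr U(y,x)]] χ({|U(y,x) − 1| < ε₀}) ρ(U). (0.16)»*

WHAT THIS MODULE TYPES / PROVES, over the cell vocabulary `Setup` (tori `Site P j`, `GaugeField`, `gaugeAct`,
`ContourData.holTo` = the averaged contour variables `U(y,x)` of (0.11) with their printed covariance, `block`, `emb`,
`fieldMeasure` = the product Haar measure `dU`, `HaarData`), `AveragingRT` (`AveragingRT.measurePreserving_mulLeft/Right`,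
`fieldMeasure_isProb`), `RegularGaugeGroup` (measurability of `Re tr`, `|· − 1|`) and `B16ZLower.zNorm`
(the normalisation `z` of (0.15), already in the tree — NOT re-declared):
* `KernelRT` / `KernelRT.T` — (0.13) in KERNEL form `(Tρ)(V) = ∫dU t(V,U)ρ(U)` (the cell's `Setup.RTOp`/`RTOpI` are
  the push-forward forms and do not expose `t`); `FineGauge u` — "u(y) = 1 for y ∈ T⁽¹⁾"; `KernelRT.FineInvariant` —
  the printed residual invariance of the kernel;
* `fpIntegrand α ε₀ u = exp[−(1/α)[1 − Re tr u]]·χ({|u − 1| < ε₀})`, `zNorm_eq_integral_fpIntegrand`;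
* **(0.15) PROVED**: `integral_comp_mul_inv` (`∫ f(Wu⁻¹)du = ∫ f(u)du`, Haar), `fp015`, `fp015_normalised`;
* `fpWeight cd α ε₀ U = Π_y Π_{x∈B(y),x≠y} z⁻¹·fpIntegrand(U(y,x))` — the gauge-fixing density of (0.16);
* `FP016` — the printed identity (0.16) as a `Prop` (for densities `ρ` invariant under the fine gauge transformations
  and integrable against the kernel), and **(0.16) PROVED**: `fp016_of_fineInvariant`, by exactly the printed
  Faddeev–Popov argument (insert (0.15), Fubini, gauge-transform `U`, Haar invariance of `dU`), under the printed
  hypotheses (kernel and density invariant under `u` with `u = 1` on `T⁽¹⁾`) plus the measure-theoretic side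
  conditions print leaves implicit (measurability of `U ↦ U(y,x)`, `z ≠ 0`, the standing range `j + 1 ≤ m + K` of
  `Setup.Params` in which `blockOf ∘ emb = id`).
Schematic simplifications: those of `Setup` (DIVERGENCE F4/F6/F7 of the cell `pub-balaban`: abstract compact group
interface, contour variables abstracted to `ContourData`, `|·|` = the interface distance `dist1`).  Nothing else of
the paper is asserted.

v1.1 (docfix, append-only in content: no declaration, statement or proof changed): cite tags on the three private
helpers (ref-3 cite lint) and cross-references to the pre-existing carriers at the loci (0.16) (lead SAMELOCUS pre-check).
-/

namespace Literature.MathematicalPhysics.QuantumFieldTheory.Balaban1983to89.B12FaddeevPopov016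

open _root_.MeasureTheory
open Literature.MathematicalPhysics.QuantumFieldTheory.Balaban1983to89

/-! ## 1. One group variable: the integrand of (0.15) and the Faddeev–Popov identity -/

section Haar

variable {G : Type*} [GaugeGroup G]

/-- The gauge-fixing integrand of (0.15)/(0.16): `exp[−(1/α)[1 − Re tr u]]·χ({|u − 1| < ε₀})`
(`χ` = the characteristic function, `|·|` = `dist1`). [cite: Balaban1987RG1, (0.15) p.254] -/
noncomputable def fpIntegrand (α ε₀ : ℝ) (u : G) : ℝ :=
  Real.exp (-(1 / α) * (1 - reTr u)) * Set.indicator {v : G | dist1 v < ε₀} (fun _ => (1 : ℝ)) u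

/-- `0 ≤ fpIntegrand α ε₀ u` (the gauge-fixing integrand of (0.15) is non-negative). [cite: Balaban1987RG1, (0.15) p.254] -/
private theorem fpIntegrand_nonneg (α ε₀ : ℝ) (u : G) : 0 ≤ fpIntegrand α ε₀ u := by
  unfold fpIntegrand
  refine mul_nonneg (Real.exp_nonneg _) ?_
  exact Set.indicator_nonneg (fun _ _ => zero_le_one) _

/-- `fpIntegrand α ε₀ u ≤ 1` for `α > 0` (the exponent of the (0.15) integrand is `≤ 0` since `Re tr u ≤ 1`).
[cite: Balaban1987RG1, (0.15) p.254] -/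
private theorem fpIntegrand_le_one {α : ℝ} (hα : 0 < α) (ε₀ : ℝ) (u : G) : fpIntegrand α ε₀ u ≤ 1 := by
  unfold fpIntegrand
  have h1 : Real.exp (-(1 / α) * (1 - reTr u)) ≤ 1 := B16ZLower.gaugeFixIntegrand_le_one hα u
  have h2 : Set.indicator {v : G | dist1 v < ε₀} (fun _ => (1 : ℝ)) u ≤ 1 :=
    Set.indicator_le_self' (fun _ _ => zero_le_one) _
  have h3 : 0 ≤ Set.indicator {v : G | dist1 v < ε₀} (fun _ => (1 : ℝ)) u :=
    Set.indicator_nonneg (fun _ _ => zero_le_one) _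
  calc Real.exp (-(1 / α) * (1 - reTr u)) * Set.indicator {v : G | dist1 v < ε₀} (fun _ => (1 : ℝ)) u
      ≤ 1 * 1 := mul_le_mul h1 h2 h3 zero_le_one
    _ = 1 := one_mul 1

/-- `|fpIntegrand α ε₀ u| ≤ 1` for `α > 0`: the gauge-fixing factor of (0.15)/(0.16) is a sub-probability
weight. [cite: Balaban1987RG1, (0.15) p.254] -/
theorem abs_fpIntegrand_le_one {α : ℝ} (hα : 0 < α) (ε₀ : ℝ) (u : G) : |fpIntegrand α ε₀ u| ≤ 1 := by
  rw [abs_of_nonneg (fpIntegrand_nonneg α ε₀ u)]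
  exact fpIntegrand_le_one hα ε₀ u

variable [MeasurableSpace G]

/-- The small-variable set `{|u − 1| < ε₀}` of (0.15) is measurable. [cite: Balaban1987RG1, (0.15) p.254] -/
private theorem measurableSet_small [RegularGaugeGroup G] (ε₀ : ℝ) :
    MeasurableSet {v : G | dist1 v < ε₀} :=
  measurableSet_lt RegularGaugeGroup.measurable_dist1 measurable_const

/-- The integrand of (0.15) is measurable (so that the `u`-integrals of (0.15) and the Fubini step of (0.16) make
sense). [cite: Balaban1987RG1, (0.15) p.254] -/
theorem measurable_fpIntegrand [RegularGaugeGroup G] (α ε₀ : ℝ) :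
    Measurable (fpIntegrand (G := G) α ε₀) := by
  unfold fpIntegrand
  exact (B16ZLower.measurable_gaugeFixIntegrand α).mul
    ((measurable_const.indicator (measurableSet_small ε₀)))

variable [HaarData G]

/-- `z` of (0.15) (the tree's `B16ZLower.zNorm`, a set integral) is the integral of `fpIntegrand` over the whole
group. [cite: Balaban1987RG1, (0.15) p.254] -/
theorem zNorm_eq_integral_fpIntegrand [RegularGaugeGroup G] (α ε₀ : ℝ) :
    B16ZLower.zNorm G α ε₀ = ∫ u, fpIntegrand α ε₀ u ∂(HaarData.haar : Measure G) := by
  unfold B16ZLower.zNorm fpIntegrand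
  rw [← integral_indicator (measurableSet_small ε₀)]
  congr 1
  funext u
  by_cases hu : u ∈ {v : G | dist1 v < ε₀}
  · simp [Set.indicator_of_mem hu]
  · simp [Set.indicator_of_notMem hu]

/-- HAAR INVARIANCE in the form used by (0.15): `∫ f(W u⁻¹) du = ∫ f(u) du` for every `W ∈ G` and every `f`
(inversion invariance followed by left invariance of the normalised Haar datum) — the first equality of (0.15).
[cite: Balaban1987RG1, (0.15) p.254] -/
theorem integral_comp_mul_inv [MeasurableMul₂ G] [MeasurableInv G] (W : G) (f : G → ℝ) :
    ∫ u, f (W * u⁻¹) ∂(HaarData.haar : Measure G) = ∫ u, f u ∂(HaarData.haar : Measure G) := by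
  let e : G ≃ᵐ G := (MeasurableEquiv.inv G).trans (MeasurableEquiv.mulLeft W)
  have he : ∀ u, e u = W * u⁻¹ := fun u => rfl
  have hmp : MeasurePreserving e (HaarData.haar : Measure G) (HaarData.haar : Measure G) := by
    refine ⟨e.measurable, ?_⟩
    have h1 : (e : G → G) = (fun u : G => W * u) ∘ (fun u : G => u⁻¹) := by funext u; rfl
    rw [h1, ← Measure.map_map (measurable_const_mul W) measurable_inv, HaarData.map_inv,
      HaarData.map_mul_left]
  have := hmp.integral_comp' f
  simpa [he] using this

/-- **(0.15) PROVED** (un-normalised form): for every `W` (= `U(y,x)`),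
`∫du exp[−(1/α)[1 − Re tr W u⁻¹]] χ({|W u⁻¹ − 1| < ε₀}) = z`. [cite: Balaban1987RG1, (0.15) p.254] -/
theorem fp015 [RegularGaugeGroup G] (α ε₀ : ℝ) (W : G) :
    ∫ u, fpIntegrand α ε₀ (W * u⁻¹) ∂(HaarData.haar : Measure G) = B16ZLower.zNorm G α ε₀ := by
  rw [integral_comp_mul_inv W (fpIntegrand α ε₀), zNorm_eq_integral_fpIntegrand]

/-- **(0.15) as printed** (normalised by `1/z`, for `z ≠ 0`): both members equal `1`. [cite: Balaban1987RG1, (0.15) p.254] -/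
theorem fp015_normalised [RegularGaugeGroup G] {α ε₀ : ℝ} (hz : B16ZLower.zNorm G α ε₀ ≠ 0) (W : G) :
    (B16ZLower.zNorm G α ε₀)⁻¹ * ∫ u, fpIntegrand α ε₀ (W * u⁻¹) ∂(HaarData.haar : Measure G) = 1 ∧
    (B16ZLower.zNorm G α ε₀)⁻¹ * ∫ u, fpIntegrand α ε₀ u ∂(HaarData.haar : Measure G) = 1 := by
  rw [fp015, ← zNorm_eq_integral_fpIntegrand]
  exact ⟨inv_mul_cancel₀ hz, inv_mul_cancel₀ hz⟩

end Haar

/-! ## 2. The lattice: kernel form (0.13), the gauge-fixing weight, and the statement (0.16) -/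

section Lattice

variable {P : Params} {j : ℕ} {G : Type*} [GaugeGroup G] [MeasurableSpace G] [HaarData G]

variable (P j G) in
/-- (0.13) in KERNEL form: a renormalization transformation given by a kernel `t(V,U)` on
`T^{(j+1)}`-fields × `T^{(j)}`-fields ("for example see the definitions in [9, 12]"). [cite: Balaban1987RG1, (0.13) p.254] -/
structure KernelRT where
  t : GaugeField P (j+1) G → GaugeField P j G → ℝ

/-- `(Tρ)(V) = ∫dU t(V,U)ρ(U)` (0.13), `dU` = the product Haar measure `Setup.fieldMeasure`. [cite: Balaban1987RG1, (0.13) p.254] -/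
noncomputable def KernelRT.T (k : KernelRT P j G) (ρ : Density P j G) : Density P (j+1) G :=
  fun V => ∫ U, k.t V U * ρ U ∂(fieldMeasure P j G)

/-- The residual gauge transformations of p. 254: "the gauge transformations u satisfying u(y) = 1 for y ∈ T⁽¹⁾"
(the coarse sites `y` sit inside the fine lattice as the block centres `emb y`). [cite: Balaban1987RG1, (0.13) p.254] -/
def FineGauge (u : GaugeTransf P j G) : Prop := ∀ y : Site P (j+1), u (emb y) = 1

/-- "t(V,U) is a gauge invariant kernel" in the form the Faddeev–Popov step uses (p. 254: "the underintegral
expression in (0.13) is still invariant with respect to the gauge transformations u satisfying u(y) = 1 for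
y ∈ T⁽¹⁾"). [cite: Balaban1987RG1, (0.13) p.254] -/
def KernelRT.FineInvariant (k : KernelRT P j G) : Prop :=
  ∀ u : GaugeTransf P j G, FineGauge u → ∀ V U, k.t V (GaugeField.gaugeAct u U) = k.t V U

/-- Invariance of a density under the residual (fine) gauge transformations. [cite: Balaban1987RG1, (0.13) p.254] -/
def FineGaugeInvariant (ρ : Density P j G) : Prop :=
  ∀ u : GaugeTransf P j G, FineGauge u → ∀ U, ρ (GaugeField.gaugeAct u U) = ρ U

omit [MeasurableSpace G] [HaarData G] in
/-- A gauge-invariant density (`Setup.GaugeField.GaugeInvariant`) is in particular fine-gauge invariant (p. 254: "If ρ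
is a gauge invariant function …"). [cite: Balaban1987RG1, (0.13) p.254] -/
theorem fineGaugeInvariant_of_gaugeInvariant {ρ : Density P j G} (h : GaugeField.GaugeInvariant ρ) :
    FineGaugeInvariant ρ := fun u _ U => h u U

/-- THE GAUGE-FIXING WEIGHT of (0.16):
`Π_{y ∈ T^{(j+1)}} Π_{x ∈ B(y), x ≠ y} (1/z) exp[−(1/α)[1 − Re tr U(y,x)]] χ({|U(y,x) − 1| < ε₀})`,
with `U(y,x) = cd.holTo U y x` the averaged contour variables (0.11) and `z = B16ZLower.zNorm G α ε₀`;
in the `k`-th step `α = g_k²` ((0.17)/(0.19)). [cite: Balaban1987RG1, (0.16) p.255] -/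
noncomputable def fpWeight (cd : ContourData P j G) (α ε₀ : ℝ) (U : GaugeField P j G) : ℝ :=
  ∏ y : Site P (j+1), ∏ x ∈ (block y).erase (emb y),
    (B16ZLower.zNorm G α ε₀)⁻¹ * fpIntegrand α ε₀ (cd.holTo U y x)

/-- **(0.16)** (p. 255), as a statement about a kernel transformation `T` (0.13): for every density `ρ`
invariant under the gauge transformations `u` with `u = 1` on `T⁽¹⁾` and integrable against the kernel,
`(Tρ)(V) = ∫dU t(V,U) · [Π_y Π_{x∈B(y),x≠y} (1/z)exp[−(1/α)[1 − Re tr U(y,x)]]χ({|U(y,x)−1| < ε₀})] · ρ(U)`.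
(The integrability side conditions are left implicit in print.) [cite: Balaban1987RG1, (0.16) p.255] -/
def FP016 (k : KernelRT P j G) (cd : ContourData P j G) (α ε₀ : ℝ) : Prop :=
  ∀ (ρ : Density P j G) (V : GaugeField P (j+1) G), FineGaugeInvariant ρ →
    Integrable (fun U => k.t V U * ρ U) (fieldMeasure P j G) →
      k.T ρ V = ∫ U, k.t V U * fpWeight cd α ε₀ U * ρ U ∂(fieldMeasure P j G)

end Lattice


/-! ## 3. (0.16) PROVED by the printed Faddeev–Popov argument (p. 255) -/

section Proof

variable {P : Params} {j : ℕ} {G : Type*} [GaugeGroup G]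

variable (P j) in
/-- The index set of the gauge-fixing factors of (0.16): pairs `(y, x)` with `y ∈ T^{(j+1)}`, `x ∈ B(y)`, `x ≠ y`
(`x ≠ emb y` on the fine lattice).  Same printed locus, different object: the pre-existing finite-dimensional
Gaussian model of the (0.16)/(2.5) gauge-fixing weight is `Beta.GaugeFixing` (`polarization_withWeight_eq_withSlice'`);
this index type is the lattice-level carrier of the product in (0.16). [cite: Balaban1987RG1, (0.16) p.255] -/
abbrev FPIdx : Type := Σ y : Site P (j+1), ((block y).erase (emb y) : Finset (Site P j))

/-- A family `g` of group elements indexed by the pairs `(y, x)` IS a gauge transformation `u` of the fine lattice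
with `u(y) = 1` at the block centres (p. 255: "the gauge transformation U → U^{u⁻¹} with u(y) = 1 for y ∈ T⁽¹⁾"):
`u(x) = g(y, x)` for `x ∈ B(y)`, `x ≠ y`, and `u = 1` at the centres.  (Pre-existing decls at the locus (0.16):
the Gaussian slice model `Beta.GaugeFixing`; the block axial gauge itself is `Setup.AxialGauge` — this is the change of
variables between the two.) [cite: Balaban1987RG1, (0.16) p.255] -/
noncomputable def fineTransf (g : FPIdx P j → G) : GaugeTransf P j G := fun x =>
  if h : x ∈ (block (blockOf x)).erase (emb (blockOf x)) then g ⟨blockOf x, ⟨x, h⟩⟩ else 1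

/-- `fineTransf g` is trivial at the block centres — "u(y) = 1 for y ∈ T⁽¹⁾" (standing range `j + 1 ≤ m + K`, where
`blockOf ∘ emb = id`). [cite: Balaban1987RG1, (0.16) p.255] -/
theorem fineTransf_emb (hj : j + 1 ≤ P.m + P.K) (g : FPIdx P j → G) (y : Site P (j+1)) :
    fineTransf g (emb y) = 1 := by
  unfold fineTransf
  have h : emb y ∉ (block (blockOf (emb y))).erase (emb (blockOf (emb y))) := by
    rw [Site.blockOf_emb hj y]
    exact Finset.notMem_erase _ _
  rw [dif_neg h]

/-- `fineTransf g` satisfies "u(y) = 1 for y ∈ T⁽¹⁾". [cite: Balaban1987RG1, (0.16) p.255] -/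
theorem fineGauge_fineTransf (hj : j + 1 ≤ P.m + P.K) (g : FPIdx P j → G) : FineGauge (fineTransf g) :=
  fun y => fineTransf_emb hj g y

/-- THE SUBSTITUTION STEP of p. 255: `U(y,x)·g(y,x)⁻¹ = U^{u}(y,x)` with `u = fineTransf g` (covariance (0.11) of
the averaged contour variables, `u(y) = 1` at the centre). [cite: Balaban1987RG1, (0.16) p.255] -/
theorem holTo_gaugeAct_fineTransf (hj : j + 1 ≤ P.m + P.K) (cd : ContourData P j G) (g : FPIdx P j → G)
    (U : GaugeField P j G) (i : FPIdx P j) :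
    cd.holTo (GaugeField.gaugeAct (fineTransf g) U) i.1 i.2 = cd.holTo U i.1 i.2 * (g i)⁻¹ := by
  obtain ⟨y, x, hx⟩ := i
  have hxy : blockOf x = y := by
    have hx' := Finset.mem_of_mem_erase hx
    simpa [block] using hx'
  dsimp only
  rw [cd.covariant, fineTransf_emb hj g y, one_mul]
  congr 2
  subst hxy
  unfold fineTransf
  rw [dif_pos hx]

/-- The weight of (0.16) as ONE product over the index set `FPIdx` (the printed double product
`Π_{y∈T⁽¹⁾} Π_{x∈B(y),x≠y}`). [cite: Balaban1987RG1, (0.16) p.255] -/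
theorem fpWeight_eq_prod [MeasurableSpace G] [HaarData G] (cd : ContourData P j G) (α ε₀ : ℝ)
    (U : GaugeField P j G) :
    fpWeight cd α ε₀ U =
      ∏ i : FPIdx P j, (B16ZLower.zNorm G α ε₀)⁻¹ * fpIntegrand α ε₀ (cd.holTo U i.1 i.2) := by
  unfold fpWeight
  rw [Fintype.prod_sigma'
    (fun (y : Site P (j+1)) (x : ((block y).erase (emb y) : Finset (Site P j))) =>
      (B16ZLower.zNorm G α ε₀)⁻¹ * fpIntegrand α ε₀ (cd.holTo U y x))]
  refine Finset.prod_congr rfl fun y _ => ?_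
  exact (Finset.prod_coe_sort _ _).symm

variable [MeasurableSpace G] [HaarData G]

/-- `dU` is invariant under gauge transformations: `∫ H(U^u) dU = ∫ H(U) dU` for EVERY `H` (left and right
invariance of Haar measure, bondwise; a measurable-equivalence, so no measurability of `H` is needed).
[cite: Balaban1985Averaging, (10) p.19] -/
theorem integral_comp_gaugeAct [MeasurableMul₂ G] (u : GaugeTransf P j G) (H : GaugeField P j G → ℝ) :
    ∫ U, H (GaugeField.gaugeAct u U) ∂(fieldMeasure P j G) = ∫ U, H U ∂(fieldMeasure P j G) := by
  let e : GaugeField P j G ≃ᵐ GaugeField P j G :=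
    MeasurableEquiv.piCongrRight fun b : PBond P j =>
      (MeasurableEquiv.mulLeft (u b.src)).trans (MeasurableEquiv.mulRight ((u b.tgt)⁻¹))
  have hmp : MeasurePreserving e (fieldMeasure P j G) (fieldMeasure P j G) := by
    have h := (AveragingRT.measurePreserving_mulRight (P := P) (j := j) (G := G) (fun b => (u b.tgt)⁻¹)).comp
      (AveragingRT.measurePreserving_mulLeft (P := P) (j := j) (G := G) (fun b => u b.src))
    refine ⟨e.measurable, ?_⟩
    have hfun : (e : GaugeField P j G → GaugeField P j G) =
        (fun (U : GaugeField P j G) (b : PBond P j) => U b * (u b.tgt)⁻¹) ∘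
          (fun (U : GaugeField P j G) (b : PBond P j) => u b.src * U b) := by
      funext U b; rfl
    rw [hfun]
    exact h.map_eq
  exact hmp.integral_comp' H

variable [RegularGaugeGroup G]

/-- **(0.16) PROVED.**  For a kernel `t` and a density `ρ` invariant under the gauge transformations `u` with
`u = 1` on `T⁽¹⁾`, measurable contour variables `U ↦ U(y,x)`, `α > 0` and `z ≠ 0`, the transform (0.13) equals the
gauge-fixed integral (0.16).  The proof is the printed one (p. 255): insert the identities (0.15) (`fp015`) under
the integral, exchange the order of integration (Fubini, `integral_integral_swap`), gauge-transform `U → U^u` with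
the `u` built from the integration variables (`fineTransf`, `holTo_gaugeAct_fineTransf`), use the invariance of
`t`, `ρ` and of `dU` (`integral_comp_gaugeAct`); the remaining `u`-integral is `1` (probability measure).
[cite: Balaban1987RG1, (0.16) p.255] -/
theorem fp016_of_fineInvariant (hj : j + 1 ≤ P.m + P.K) (k : KernelRT P j G) (hk : k.FineInvariant)
    (cd : ContourData P j G) (hcd : ∀ (y : Site P (j+1)) (x : Site P j), Measurable fun U : GaugeField P j G => cd.holTo U y x)
    {α ε₀ : ℝ} (hα : 0 < α) (hz : B16ZLower.zNorm G α ε₀ ≠ 0) : FP016 k cd α ε₀ := by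
  intro ρ V hρ hint
  set z : ℝ := B16ZLower.zNorm G α ε₀ with hzdef
  set η : Measure (FPIdx P j → G) := Measure.pi fun _ => (HaarData.haar : Measure G) with hη
  -- the integrand of the doubled integral
  set F : GaugeField P j G → (FPIdx P j → G) → ℝ :=
    fun U g => k.t V U * ρ U * ∏ i : FPIdx P j, z⁻¹ * fpIntegrand α ε₀ (cd.holTo U i.1 i.2 * (g i)⁻¹) with hF
  -- Step 1 (insert (0.15)): for every `U` the `g`-integral of the product of the factors is `1`.
  have h1 : ∀ U : GaugeField P j G,
      ∫ g, (∏ i : FPIdx P j, z⁻¹ * fpIntegrand α ε₀ (cd.holTo U i.1 i.2 * (g i)⁻¹)) ∂η = 1 := by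
    intro U
    rw [hη, integral_fintype_prod_eq_prod
      (fun (i : FPIdx P j) (w : G) => z⁻¹ * fpIntegrand α ε₀ (cd.holTo U i.1 i.2 * w⁻¹))]
    refine Finset.prod_eq_one fun i _ => ?_
    rw [integral_const_mul, fp015, hzdef, inv_mul_cancel₀ hz]
  -- Step 2: `(Tρ)(V) = ∫dU ∫dg F`.
  have h2 : k.T ρ V = ∫ U, ∫ g, F U g ∂η ∂(fieldMeasure P j G) := by
    unfold KernelRT.T
    refine integral_congr_ae (Filter.Eventually.of_forall fun U => ?_)
    simp only [hF]
    rw [integral_const_mul, h1 U, mul_one]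
  -- Step 3: Fubini.
  have hF_int : Integrable (Function.uncurry F) ((fieldMeasure P j G).prod η) := by
    have ha : Integrable (fun p : GaugeField P j G × (FPIdx P j → G) => k.t V p.1 * ρ p.1) ((fieldMeasure P j G).prod η) :=
      hint.comp_fst η
    have hb_meas : Measurable (fun p : GaugeField P j G × (FPIdx P j → G) =>
        ∏ i : FPIdx P j, z⁻¹ * fpIntegrand α ε₀ (cd.holTo p.1 i.1 i.2 * (p.2 i)⁻¹)) := by
      refine Finset.measurable_prod _ fun i _ => ?_
      have hm1 : Measurable fun p : GaugeField P j G × (FPIdx P j → G) => cd.holTo p.1 i.1 i.2 :=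
        (hcd i.1 i.2).comp measurable_fst
      have hm2 : Measurable fun p : GaugeField P j G × (FPIdx P j → G) => (p.2 i)⁻¹ :=
        ((measurable_pi_apply i).comp measurable_snd).inv
      exact (measurable_const.mul (measurable_fpIntegrand α ε₀)).comp (hm1.mul hm2)
    have hb_bdd : ∀ p : GaugeField P j G × (FPIdx P j → G),
        ‖∏ i : FPIdx P j, z⁻¹ * fpIntegrand α ε₀ (cd.holTo p.1 i.1 i.2 * (p.2 i)⁻¹)‖
          ≤ |z|⁻¹ ^ Fintype.card (FPIdx P j) := by
      intro p
      rw [Real.norm_eq_abs, Finset.abs_prod, ← Finset.card_univ, ← Finset.prod_const]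
      refine Finset.prod_le_prod (fun i _ => abs_nonneg _) fun i _ => ?_
      rw [abs_mul, abs_inv]
      calc |z|⁻¹ * |fpIntegrand α ε₀ (cd.holTo p.1 i.1 i.2 * (p.2 i)⁻¹)|
          ≤ |z|⁻¹ * 1 := mul_le_mul_of_nonneg_left (abs_fpIntegrand_le_one hα ε₀ _) (inv_nonneg.2 (abs_nonneg z))
        _ = |z|⁻¹ := mul_one _
    have h := ha.bdd_mul hb_meas.aestronglyMeasurable (Filter.Eventually.of_forall hb_bdd)
    refine h.congr (Filter.Eventually.of_forall fun p => ?_)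
    simp only [hF, Function.uncurry]
    ring
  rw [h2, integral_integral_swap hF_int]
  -- Step 4: for fixed `g` gauge-transform `U`; the inner integral no longer depends on `g`.
  have h4 : ∀ g : FPIdx P j → G, ∫ U, F U g ∂(fieldMeasure P j G) = ∫ U, k.t V U * fpWeight cd α ε₀ U * ρ U ∂(fieldMeasure P j G) := by
    intro g
    have hu : FineGauge (fineTransf g) := fineGauge_fineTransf hj g
    have hpt : ∀ U : GaugeField P j G, F U g =
        (fun W : GaugeField P j G => k.t V W * fpWeight cd α ε₀ W * ρ W) (GaugeField.gaugeAct (fineTransf g) U) := by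
      intro U
      simp only [hF]
      rw [hk _ hu V U, hρ _ hu U, fpWeight_eq_prod]
      simp_rw [holTo_gaugeAct_fineTransf hj cd g U]
      ring
    simp_rw [hpt]
    exact integral_comp_gaugeAct (fineTransf g) (fun W : GaugeField P j G => k.t V W * fpWeight cd α ε₀ W * ρ W)
  simp_rw [h4]
  rw [integral_const, hη]
  simp

end Proof

end Literature.MathematicalPhysics.QuantumFieldTheory.Balaban1983to89.B12FaddeevPopov016
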